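import Literature.NumberTheory.EllipticCurves.Kato2004.EllipticUnitZetaClassComparison
import HarnessLib

/-!
# Kato 2004 (Astérisque 295) (15.16.1) read on the pinned carriers after `⊗ ℚ` — F-P1′: the NORMALISATION-FREE letter of
# `CM.kato15161_ellipticUnitClass_res_zetaFamily` (F-P1, p821323), i.e. F-P1 with the Néron/Tate-duality clause (A2) of its
# realised-family antecedent dropped

Topic `NumberTheory/EllipticCurves`, sub-directory `Kato2004`, namespace `…Kato2004.CM`.  ONE named fact (`def … : Prop`, D-0014:
nothing asserted, no `_holds`; PUBLISHED: Kato (15.16.1) with (15.6.1)–(15.6.3), (15.12.1), 15.13/15.14, Thm. 12.5 (1), §13.9,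
Lemma 13.10 (1) — exactly F-P1's print) and ONE proved theorem (`…_of_free`: F-P1′ → F-P1, the λ-term discarding a hypothesis);
no instance, no notation, no `sorry`.  Typed by seat `bsd-cm-k-ty1` g35 (literature-prover, cell bsd-cm) on the pen's ruling D1147
((β′) ADOPTED) with the PRICE OF RECORD D1148 (a)–(d) / D1149 and the critic's certificate idea-crit-15 g19 NOTE #25 (print
coverage CONFIRMED; the Σ₁/(R) mechanism below is the critic's corrected text) / NOTE #26 (two delete-hunks; probe
`FP1free_probe_g19.lean` 1eb0bd8fad37ec7c — this file's `def` body is that probe's body token for token).  F-P1 (p821323) stays in the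
tree as the weaker sibling; it SUPERSEDES nothing but is referenced by nothing once the crux skeleton's closing touch points at F-P1′.

## What changed w.r.t. F-P1, and why the printed content is the same

THE LETTER: F-P1's `def` body (`EllipticUnitZetaClassComparison.lean` l.180–302) with EXACTLY two deletions — (i) the binding
`letI ρT := restrictedTateRep W ℚ_v p` (used only by (A2)), (ii) the (A2) clause of the «(A1) ∧ (A2)» binder, which now reads
`(∃ d, DefinedExpStarBody W p nf d ιcyc ((q : ℚ) : ℝ) Λv) →`; every other byte identical (binders, the `letI` chain of `ℚ_v`, the
CONCLUSION).  F-P1's (A2) was «`S(d) := exp*_d(Z¹(ℚ_p, T_pW)) = R := {a : a · padicLogLocal W p (W(ℚ_p)) ⊆ 𝓞}`», the Tate-duality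
/ Néron normalisation of the generator `d`, copied with the other binders from `HasRealisedZetaFamilyBody` (D1111 (x1)); the
consumer (crux `EllipticUnitValueSevenOfGZK`, (S-D-★′)) must instantiate the fact at the maximal-order PARTNER of a `𝒞₇` member with
TRANSPORTED data, and (A2)'s right-hand side — the partner's own formal logarithm on its own `ℚ_p`-points — is not reachable from
the member by any lemma of the tree (no point map on `ℚ_p`-points is attached to an `Isogeny`; `padicLogPoint`/`padicLogLocal` have no
functoriality under isogeny), whereas (A0), (A1), (A3), (A4) transport by kernel theorems (`definedExpStarBody_isogeny_transport`,
`ZetaBody.isogeny_transport`, `PartnerTransport.transportQ_proj_eq_levelToLayer`) — STATUS finding of 2026-08-31, pen D1147.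

WHY F-P1′ HAS THE SAME PRINTED CONTENT (critic NOTE #25 (3), adopted D1148).  (A2) dropped.  The CONCLUSION is a class identity in
`IK.H` in the symbols `t, α₀, α₁, w, katoMultiplier …, F.iwasawaClass u …, IK.isogenyMap φ, binomialSeries (artinExponent … 𝔟),
Ideal.absNorm 𝔟, Nb, I.resOver IK hγ hγK y` — it mentions NONE of `d, q, Λv, x, e` (no value, no period, no generator); the generator
enters only through the ANTECEDENT, which is invariant under Σ₁ : `(d, q, Λv, x, e) ↦ (ν • d, ν⁻¹q, ν⁻¹ • Λv, ν⁻¹ • x, e + v_p(ν))`,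
`ν ∈ ℚˣ`, with the classes `z`, the lift `y`, the family `(c, d₁, a, A, d′)`, `qm, nᵢ, σ_c, σ_d, σ_ℓ, perRatio` — hence `M̃` — UNCHANGED:
(A0) trivially; (A1) (RES) by `expStarCoord_smul_generator` / `FilZeroLine.dualExpCoord_smul` (any scalar `≠ 0`, hypothesis-free;
tower generator `d_{w₀} ↦ ν • d_{w₀}`) and (DEF) by the displayed `ℚ_p`-semilinearity of `Ψ` + `galAdicCompletionMap_algebraMap_adicCompletion`
— the first half of the proof of `definedExpStarBody_units_smul` (`DefinedExpStarBodyScalingProofs.lean`) —, the internal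
`ZetaBody` half with witnesses `(z, ν⁻¹x)` by `zetaBody_rat_smul ν⁻¹`; (A3) by `zetaBody_rat_smul`; (A4) untouched; (A5′) is about `nf`
only; (A6′): `plusPeriod nf = perRatio·realPeriodRat` untouched and `padicValRat p (perRatio/(ν⁻¹q·qm)) = e + v_p(ν)` — `e` is ∀-bound and
absent from the conclusion.  F-P1's clause (A2) «`S(d) = R`» satisfies `S(ν • d) = ν⁻¹S(d)` and `R` is `ℤ_pˣ`-stable, so (A2) is invariant
under `p`-adic units and Σ₁ with `ν = p^j` shifts it by `p^{−j}`: every Σ₁-orbit of antecedents contains an (A2)-normalised representative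
iff `S(d)` and `R` are rank-one `ℤ_p`-lattices of the line `ℚ_v` — (R), TRUE in print (`exp* : H¹(ℚ_p, V) → D⁰_dR(V)` is surjective
[BlochKato1990, Ex. 3.11: dual of the injective `exp`, `D_cris(V_pA)^{φ=1} = 0`]; `H¹(ℚ_p, T)` is compact; `log(A(ℚ_p))` is compact open) and
out of kernel reach (even «`S(d)` is a `ℤ_p`-submodule» needs `FilZeroLine.dualExpCoord_add (hinj : CupLogInjective) (HasDualExp …)`,
`NeronDeRhamDatum.lean`, because of the junk branch of `dualExpCoord`).  Therefore F-P1′ ⟸ F-P1 ∧ (R) with the SAME `(t, α₀, α₁, w)`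
for the same `(z, y, M̃)`, and F-P1′ → F-P1 is the λ-term discarding a hypothesis (`kato15161_ellipticUnitClass_res_zetaFamily_of_free`
below): F-P1′ asserts about every `(z, y, M̃)` exactly what F-P1 asserts about it in the normalised representative — the same printed
content, since (15.16.1) (p. 265 l. 27–37) is the CLASS identity «(15.12.1) sends `z_{p^∞𝔣} ⊗ γ ⊗ ζ_{p^∞}^{⊗(−1)}` to `z^{(p)}_{γ′}`»,
differential-free, and Thm. 12.5 (1) (p. 221) states the values through `per_f(x)^±` on `S(f) ⊗ ℚ(ζ_{p^n})`, coordinate-free; the Néron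
model occurs in Kato only at 17.5 (p. 274, «ω is good for T»), the `p`-adic-L-function normalisation, which neither letter uses; the tree's
constant `q` of (A0)/(A1)/(A3) already absorbs the choice of generator.  In-kernel (R) being out of reach is WHY F-P1′ is a LETTER (a
named fact with its own cite) and not a corollary of F-P1.  (Also invariant, not needed: Σ₂ `(d, Λv, z, y, w) ↦ (u • d, u⁻¹ • Λv, u • z,
u • y, C(u⁻¹)·w)`, `u ∈ ℤ_pˣ` — `definedExpStarBody_units_smul`, `zetaBody_units_smul`.)  D-0026: F-P1′ is not stronger than its
printed source; it is freed of a normalisation our ∃-typing of the realised family never used.  Scope, honest label, «what this is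
NOT», TODO(general form) — VERBATIM as in F-P1's module docstring (`EllipticUnitZetaClassComparison.lean`), not repeated here.

## References

* [Kato2004Asterisque] K. Kato, *p-adic Hodge theory and values of zeta functions of modular forms*, Astérisque 295 (2004):
  §15.5–15.6 (15.6.1)–(15.6.3) (pp. 253–254), §15.8 (pp. 256–257), Lemma 15.11 (15.11.2)–(15.11.3) (pp. 260–263), §15.12
  (15.12.1)–(15.12.2) (p. 263), Lemma 15.13 and 15.14 (p. 264), §15.15–15.16 (15.16.1), Prop. 15.17 (p. 265); Thm. 12.4 (2),
  Thm. 12.5 (1) (p. 221), §13.9 (p. 230), Lemma 13.10 (1) (p. 230), 17.5 (p. 274). [store `paper:doi-10-24033-ast-639` p0150 L27–37, p0106, p0159]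
* [BlochKato1990] S. Bloch, K. Kato, *L-functions and Tamagawa numbers of motives* (1990), §3, Def. 3.10, Example 3.11 (p. 361).
* [Rubin2000] K. Rubin, *Euler Systems* (2000), App. B §2–§3.  [NeukirchSchmidtWingberg2008] I §5 (1.5.6)–(1.5.7).  [Washington1997] §13.1–13.2.
* Tree: `Kato2004/EllipticUnitZetaClassComparison.lean` (F-P1, p821323), `Kato2004/DefinedExpStarBodyIsogenyTransport.lean` ((T5-nat)),
  `Kato2004/DefinedExpStarBodyScalingProofs.lean`, `Kato2004/ZetaClassOnRankLeOneBranch.lean` ((A0)–(A6′) binders), `PAdicHodge/NeronDeRhamDatum.lean`.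
  Cell records: STATUS D1147–D1149; critic NOTEs #25–#26; `Cruxes/EllipticUnitValueSevenOfGZK/PRINTFACTS-v19.md`.
-/

noncomputable section

open scoped BigOperators NumberField TensorProduct Classical
open Field IsDedekindDomain NumberField CongruenceSubgroup ValuativeRel
open Literature.NumberTheory.GaloisRepresentations
open Literature.NumberTheory.GaloisRepresentations.PeriodRingData
open Literature.NumberTheory.GaloisRepresentations.IsNonarchimedeanLocalField
open Literature.NumberTheory.PAdicHodge
open Literature.NumberTheory.EllipticCurves Literature.NumberTheory.EllipticCurves.ModularForms
open Literature.NumberTheory.AdelicBaseChange Literature.NumberTheory.Automorphic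
open Literature.NumberTheory.ComplexMultiplication.EllipticUnits
open WeierstrassCurve (geomPoints geomTorsion)

namespace Literature.NumberTheory.EllipticCurves.Kato2004

open EulerSystemValues Rat.HeightOneSpectrum

namespace CM

set_option backward.isDefEq.respectTransparency false in
/-- **Kato 2004, (15.16.1) read on the pinned carriers after `⊗ ℚ` — F-P1′, the normalisation-free letter of F-P1
(`kato15161_ellipticUnitClass_res_zetaFamily`)**: for `W/ℚ` globally minimal with CM by the maximal order of `K` and `(ψ, ι, f)` admissible
EXACTLY as in `prop159_kummerCup_expStar_values`; for a prime `p` such that every prime factor `ℓ ≠ p` of `f` is a prime of bad reduction of `W`;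
for a cyclotomic `ℤ_p`-extension `κ` of `ℚ` with topological generator `γ` and a pin `I`; for the restricted tower `κ.restrict K h` with
topological generator `γK` and a pin `IK`; for a Kummer frame `F` of `W_K` at `p` on the ray-class tower with `e ≠ 0` and `hV`; for a
`K`-endomorphism `φ` with `φ ∘ φ = [m]`, `m < 0`; and for EVERY value-pinned `(c, d₁, a, A)`-family REALISED in `I.H` with lift `y` — the
binders (A0), (A1), (A3), (A4), (A5′), (A6′-scalars) of `HasRealisedZetaFamilyBody`, universally quantified, WITHOUT the Néron
normalisation (A2) of the generator `d` (this is the one difference from F-P1; see the module docstring for why the printed content is the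
same: the conclusion never mentions `d`, and the antecedent is `ℚˣ`-rescaling invariant except for (A2)): THERE ARE `t ∈ ℕ`,
`(α₀, α₁) ∈ ℤ_p² ∖ {0}` and `w ∈ Λˣ` such that for EVERY ideal `𝔟` prime to `6pf`, EVERY unit tower `u` on `F` pinned to Kato's `_𝔟z_{p^s𝔣}`
at the levels `s ≥ 1`, and ALL integers `(b₀, b₁, N_b)`, `N_b ≠ 0`, with `N_b·(σ_𝔟 · e_k) = b₀·e_k + b₁·φ(e_k)` (`k ≤ s`, `1 ≤ s`):
`(b₀ + b₁φ_*)·(p^t M̃)·euK 𝔟 = N𝔟 · ((b₀ + b₁φ_*) − N_b σ_𝔟) · (C α₀ + C α₁ φ_*) · (w · res y)` in `IK.H` — LETTER FOR LETTER F-P1's conclusion.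
CONTENT: (15.16.1) with (15.6.1)–(15.6.3), the diagonal action of (15.12.1)/15.13–15.14, Thm. 12.5 (1)/§13.9 and Lemma 13.10 (1), read
AFTER `⊗ ℚ`; the integrality of the constant at `π` is NOT asserted (crux K2ᶜ); no value of `ψ`, no orientation convention, no
normalisation of the generator enters.  Printed for `K ⊄ ℚ(ζ_{p^∞})`, asserted «similarly by 15.14» for `K ⊂ ℚ(ζ_{p^∞})`.  Named fact;
nothing asserted; no `_holds` expected (size XL).  It implies F-P1 (`…_of_free`).
[cite: Kato2004Asterisque, §15.16 (15.16.1) (p. 265), with §15.6 (15.6.1)–(15.6.3) (p. 254), §15.12 (15.12.1) (p. 263), Lemma 15.13 and 15.14 (p. 264), Prop. 15.17 proof, last line (p. 265), Thm. 12.5 (1) (p. 221), §13.9 (p. 230 l. 8–9), Lemma 13.10 (1) (p. 230)]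
[cite: BlochKato1990, §3 Def. 3.10 and Example 3.11 (p. 361)] [cite: Rubin2000, App. B §2–§3] [cite: NeukirchSchmidtWingberg2008, I §5 (1.5.6)–(1.5.7)]
[cite: Washington1997, §13.1–13.2] -/
def kato15161_ellipticUnitClass_res_zetaFamily_free : Prop :=
  ∀ (W : WeierstrassCurve ℚ) [W.IsElliptic] [W.IsGloballyMinimal], W.j ∈ maximalCMJInvariants →
  ∀ (K : Type) [Field K] [NumberField K], IsCMFieldOfJ K W.j →
  ∀ (ψ : HeckeCharacter K), ψ.HasInfinityType (fun _ ↦ 1) (fun _ ↦ 0) →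
    (∀ s : ℂ, 3 / 2 < s.re → heckeLFunction ψ s = W.LSeries s) →
  ∀ (ι : AlgebraicClosure K →+* ℂ),
    (∀ (w : InfinitePlace K) (x : K), ι (algebraMap K (AlgebraicClosure K) x) = w.embedding x) →
  ∀ (f : ℕ), 3 ≤ f →
    (∀ α : 𝓞 K, α ≠ 0 → ((f : ℕ) : 𝓞 K) ∣ α - 1 →
      heckeCharIdealValue ψ (Ideal.span {α}) = ι (algebraMap K (AlgebraicClosure K) (α : K))) →
  ∀ (p : ℕ) [Fact p.Prime] [ContinuousSMul ℤ_[p] (W.tateModule p)]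
    [ContinuousSMul ℤ_[p] ((W.baseChange K).tateModule p)],
  -- SUPPORT OF `f`: every prime factor of `f` other than `p` is a prime of BAD reduction of `W` (then `ψ` vanishes at every
  -- prime of `K` dividing `f` and prime to `p`, so Prop. 15.9's `L_{p𝔣}` and Thm. 12.5 (1)'s `L_{(p)}` deplete the same
  -- Euler factors; for a general `f` with `cond ψ ∣ (f)` the two sides below differ by `∏_{𝔩∣f, 𝔩∤p·cond ψ}(1 − ψ̄(𝔩)N𝔩⁻¹σ_𝔩)`)
  (∀ (ℓ : ℕ) [Fact ℓ.Prime], ℓ ∣ f → ℓ ≠ p → ¬ W.HasGoodReductionAtPrime ℓ) →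
  -- the `ℚ`-side pin: a cyclotomic `ℤ_p`-extension of `ℚ`, a topological generator, the Δ-trivial Iwasawa cohomology
  ∀ (κ : ZpExtension ℚ p) (hκ : κ.IsCyclotomic) (γ : absoluteGaloisGroup ℚ) (hγ : κ.IsTopGenerator γ)
    (I : IwasawaH1Data W p κ γ),
  -- the `K`-side pin: the restricted tower `Kℚ_∞/K`, a topological generator, the `K`-side Iwasawa cohomology (15.14)
  ∀ (h : Function.Surjective (κ.toContinuousMonoidHom.comp (absGaloisRestrict ℚ K))) (γK : absoluteGaloisGroup K)
    (hγK : (κ.restrict K h).IsTopGenerator γK) (IK : IwasawaH1DataOver (W.baseChange K) p (κ.restrict K h) γK),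
  -- the Kummer frame on the ray-class tower (as in `h159′`), `e ≠ 0`, and the cyclotomic layers inside the Kummer levels
  ∀ (F : KummerFrame (W.baseChange K) p),
    (∀ s : ℕ, F.V s = torsionLayer (W.baseChange K) (p ^ s * f)) → (∃ k : ℕ, F.e k ≠ 0) →
  ∀ (hV : ∀ n : ℕ, F.V (n + 1) ≤ (κ.restrict K h).layerSubgroup n),
  -- the complex multiplication: a `K`-endomorphism `φ` with `φ ∘ φ = [m]`, `m < 0` (so `ℚ(φ) = K` inside `End ⊗ ℚ`)
  ∀ (φ : WeierstrassCurve.Isogeny (W.baseChange K) (W.baseChange K)) (m : ℤ), m < 0 →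
    (∀ P : geomPoints (W.baseChange K), φ (φ P) = m • P) →
  -- ONE REALISED value-pinned family: VERBATIM the binders (A0)–(A4), (A5′), (A6′-scalars) of `HasRealisedZetaFamilyBody`
  -- (CLOSED form: the `ℤ_p`-structure facts of `T_pW` supplied by the tree theorems, as in `ZetaClassPosition`)
  letI : Module.Free ℤ_[p] (W.tateModule p) := W.module_free_tateModule_holds p
  letI : Module.Finite ℤ_[p] (W.tateModule p) := W.module_finite_tateModule_holds p
  letI : ValuativeRel (NumberField.Place.Completion (Sum.inr ((Rat.HeightOneSpectrum.primesEquiv (R := 𝓞 ℚ)).symm ⟨p, Fact.out⟩) : NumberField.Place ℚ)) :=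
    inferInstanceAs (ValuativeRel (((Rat.HeightOneSpectrum.primesEquiv (R := 𝓞 ℚ)).symm ⟨p, Fact.out⟩).adicCompletion ℚ))
  letI : TopologicalSpace (NumberField.Place.Completion (Sum.inr ((Rat.HeightOneSpectrum.primesEquiv (R := 𝓞 ℚ)).symm ⟨p, Fact.out⟩) : NumberField.Place ℚ)) :=
    inferInstanceAs (TopologicalSpace (((Rat.HeightOneSpectrum.primesEquiv (R := 𝓞 ℚ)).symm ⟨p, Fact.out⟩).adicCompletion ℚ))
  haveI : IsNonarchimedeanLocalField (NumberField.Place.Completion (Sum.inr ((Rat.HeightOneSpectrum.primesEquiv (R := 𝓞 ℚ)).symm ⟨p, Fact.out⟩) : NumberField.Place ℚ)) :=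
    inferInstanceAs (IsNonarchimedeanLocalField (((Rat.HeightOneSpectrum.primesEquiv (R := 𝓞 ℚ)).symm ⟨p, Fact.out⟩).adicCompletion ℚ))
  haveI : CharZero (NumberField.Place.Completion (Sum.inr ((Rat.HeightOneSpectrum.primesEquiv (R := 𝓞 ℚ)).symm ⟨p, Fact.out⟩) : NumberField.Place ℚ)) := LocalField.charZero_adicCompletion ((Rat.HeightOneSpectrum.primesEquiv (R := 𝓞 ℚ)).symm ⟨p, Fact.out⟩)
  letI : Algebra ℚ_[p] (NumberField.Place.Completion (Sum.inr ((Rat.HeightOneSpectrum.primesEquiv (R := 𝓞 ℚ)).symm ⟨p, Fact.out⟩) : NumberField.Place ℚ)) :=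
    LocalField.adicCompletionPadicAlgebra ((Rat.HeightOneSpectrum.primesEquiv (R := 𝓞 ℚ)).symm ⟨p, Fact.out⟩) p ((natCast_mem_asIdeal_iff_eq_primesEquiv_symm _ (Fact.out : p.Prime)).mpr rfl)
  haveI : Fact (¬ IsUnit ((p : ℕ) : integerC (NumberField.Place.Completion (Sum.inr ((Rat.HeightOneSpectrum.primesEquiv (R := 𝓞 ℚ)).symm ⟨p, Fact.out⟩) : NumberField.Place ℚ)))) :=
    ⟨not_isUnit_natCast_integerC (show valuation (NumberField.Place.Completion (Sum.inr ((Rat.HeightOneSpectrum.primesEquiv (R := 𝓞 ℚ)).symm ⟨p, Fact.out⟩) : NumberField.Place ℚ)) ((p : ℕ) : (NumberField.Place.Completion (Sum.inr ((Rat.HeightOneSpectrum.primesEquiv (R := 𝓞 ℚ)).symm ⟨p, Fact.out⟩) : NumberField.Place ℚ))) < 1 from LocalField.valuation_adicCompletion_natCast_lt_one ((Rat.HeightOneSpectrum.primesEquiv (R := 𝓞 ℚ)).symm ⟨p, Fact.out⟩) p ((natCast_mem_asIdeal_iff_eq_primesEquiv_symm _ (Fact.out : p.Prime)).mpr rfl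))⟩
  haveI := isAdicComplete_integerC_natCast (show valuation (NumberField.Place.Completion (Sum.inr ((Rat.HeightOneSpectrum.primesEquiv (R := 𝓞 ℚ)).symm ⟨p, Fact.out⟩) : NumberField.Place ℚ)) ((p : ℕ) : (NumberField.Place.Completion (Sum.inr ((Rat.HeightOneSpectrum.primesEquiv (R := 𝓞 ℚ)).symm ⟨p, Fact.out⟩) : NumberField.Place ℚ))) < 1 from LocalField.valuation_adicCompletion_natCast_lt_one ((Rat.HeightOneSpectrum.primesEquiv (R := 𝓞 ℚ)).symm ⟨p, Fact.out⟩) p ((natCast_mem_asIdeal_iff_eq_primesEquiv_symm _ (Fact.out : p.Prime)).mpr rfl))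
  -- the tree's `ℚ`-algebra structure on `ℚ_v` (the one W2's restricted representations are built on) is pinned
  -- as the most recent local instance, so that it — and not `DivisionRing.toRatAlgebra` — is synthesized below
  letI : Algebra ℚ (NumberField.Place.Completion (Sum.inr ((Rat.HeightOneSpectrum.primesEquiv (R := 𝓞 ℚ)).symm ⟨p, Fact.out⟩) : NumberField.Place ℚ)) := NumberField.Place.instAlgebraCompletion (Sum.inr ((Rat.HeightOneSpectrum.primesEquiv (R := 𝓞 ℚ)).symm ⟨p, Fact.out⟩) : NumberField.Place ℚ)
  ∀ (hp : p ≠ 2) (N : ℕ) (_ : NeZero N) (nf : CuspForm (Gamma0 N) 2) (_ : IsNewformOf W nf)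
    (ιcyc : (n : ℕ) → (CyclotomicField n ℚ →+* ℂ)) (q : ℚ)
    (Λv : ∀ (k : ℕ) (r : Finset (HeightOneSpectrum (𝓞 ℚ))),
      H1 (tateRep W p) (cycSubgroup p k r) →ₗ[ℤ_[p]] ℚ_[p] ⊗[ℚ] CyclotomicField (cycLevel p k r) ℚ),
    -- (A0)
    q ≠ 0 →
    -- (A1): SOME generator `d` of the line `D⁰_dR(V_pW|Γ_{ℚ_v})` with Kato's matrix over the DEFINED exp* (F-P1's (A2) DROPPED)
    (∃ d, DefinedExpStarBody W p nf d ιcyc ((q : ℚ) : ℝ) Λv) →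
    -- (A3)
    ∀ (c d₁ a : ℤ) (A : ℕ) (d' : ℤ),
      0 < A → Int.gcd c (6 * p * A) = 1 → Int.gcd d₁ (6 * p * N) = 1 → (d₁ : ℤ) * d' ≡ 1 [ZMOD (A : ℤ)] →
      ratCuspFactor nf true c d₁ a A d' ≠ 0 →
    ∀ (z : ∀ (k : ℕ) (r : (cyclotomicLevelsRat p (badPlaces c d₁ A N)).Ideals),
        H1 (tateRep W p) ((cyclotomicLevelsRat p (badPlaces c d₁ A N)).level k r.1))
      (x : ∀ (k : ℕ) (r : (cyclotomicLevelsRat p (badPlaces c d₁ A N)).Ideals),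
        CyclotomicField (cycLevel p k r.1) ℚ),
      ZetaBody W p nf ιcyc ((q : ℚ) : ℝ) Λv c d₁ a A z x →
    -- (A4) the realisation datum: the Λ-adic lift `y ∈ I.H`
    ∀ (y : I.H),
      (∀ n : ℕ, I.proj n y =
        levelToLayer W p hκ hp (badPlaces c d₁ A N) n
          (z (n + 1) (cyclotomicLevelsRat p (badPlaces c d₁ A N)).idealOne)) →
    -- (A5′) ∧ (A6′-scalars)
    ∀ (qm perRatio : ℚ) (e : ℤ) (n₁ n₂ n₃ n₄ : ℤ) (σc σd : absoluteGaloisGroup ℚ)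
      (σℓ : ℕ → absoluteGaloisGroup ℚ),
      0 < qm → AddSubgroup.closure (Set.range (ratMinusSymbol nf)) = AddSubgroup.zmultiples qm →
      ratMinusSymbol nf ((a : ℚ) / A) = n₁ * qm → ratMinusSymbol nf ((a * c : ℚ) / A) = n₂ * qm →
      ratMinusSymbol nf ((a * d' : ℚ) / A) = n₃ * qm → ratMinusSymbol nf ((a * c * d' : ℚ) / A) = n₄ * qm →
      ((GaloisRep.cyclotomicCharacter ℚ p σc : ℤ_[p]ˣ) : ℤ_[p]) = c →
      ((GaloisRep.cyclotomicCharacter ℚ p σd : ℤ_[p]ˣ) : ℤ_[p]) = d₁ →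
      (∀ ℓ ∈ A.primeFactors.erase p, ((GaloisRep.cyclotomicCharacter ℚ p (σℓ ℓ) : ℤ_[p]ˣ) : ℤ_[p]) = ℓ) →
      perRatio ≠ 0 → plusPeriod nf = ((perRatio : ℚ) : ℝ) * W.realPeriodRat →
      padicValRat p (perRatio / (q * qm)) = e →
    -- CONCLUSION: ONE constant `p^{-t}·(α₀ + α₁φ)·w` for the frame, the endomorphism and the family …
    ∃ (t : ℕ) (α₀ α₁ : ℤ_[p]) (_ : α₀ ≠ 0 ∨ α₁ ≠ 0) (w : (IwasawaAlgebra p)ˣ),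
      -- … such that for EVERY admissible twist, EVERY pinned unit tower and ALL coordinates of `[ε_𝔟]` on the `e_k` …
      ∀ 𝔟 : Ideal (𝓞 K), IsCoprime 𝔟 (Ideal.span {((6 * p * f : ℕ) : 𝓞 K)}) →
      ∀ u : F.UnitTower, (∀ s : ℕ, 1 ≤ s → IsKatoUnitRepAt p ι (Ideal.span {((f : ℕ) : 𝓞 K)}) s 𝔟 (u.z s)) →
      ∀ (b₀ b₁ : ℤ) (Nb : ℕ), Nb ≠ 0 →
        (∀ k s : ℕ, k ≤ s → 1 ≤ s →
          (Nb : ℤ) • ((layerArtin p (Ideal.span {((f : ℕ) : 𝓞 K)}) s 𝔟 • F.e k :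
              geomTorsion (W.baseChange K) ((p : ℤ) ^ k)) : geomPoints (W.baseChange K)) =
            b₀ • ((F.e k : geomTorsion (W.baseChange K) ((p : ℤ) ^ k)) : geomPoints (W.baseChange K)) +
              b₁ • φ ((F.e k : geomTorsion (W.baseChange K) ((p : ℤ) ^ k)) : geomPoints (W.baseChange K))) →
        -- … (15.16.1) after `⊗ ℚ`: `[ε_𝔟]·(p^t M̃)·euK 𝔟 = N𝔟·([ε_𝔟] − σ_𝔟)·(α₀ + α₁φ)·w·res y` (times `N_b`), in `IK.H`
        ((b₀ : IwasawaAlgebra p) * ((p : IwasawaAlgebra p) ^ t *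
            katoMultiplier p c d₁ n₁ n₂ n₃ n₄
              ((IwasawaCharacter.Psi p ℤ_[p] κ σc : (PowerSeries ℤ_[p])ˣ) : IwasawaAlgebra p)
              ((IwasawaCharacter.Psi p ℤ_[p] κ σd : (PowerSeries ℤ_[p])ˣ) : IwasawaAlgebra p)
              (A.primeFactors.erase p) (fun ℓ => W.LFunction ℓ) (fun ℓ => if ℓ ∣ N then 0 else 1)
              (fun ℓ => ((IwasawaCharacter.Psi p ℤ_[p] κ (σℓ ℓ) : (PowerSeries ℤ_[p])ˣ) : IwasawaAlgebra p)))) •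
            F.iwasawaClass u (κ.restrict K h) hV IK +
          ((b₁ : IwasawaAlgebra p) * ((p : IwasawaAlgebra p) ^ t *
            katoMultiplier p c d₁ n₁ n₂ n₃ n₄
              ((IwasawaCharacter.Psi p ℤ_[p] κ σc : (PowerSeries ℤ_[p])ˣ) : IwasawaAlgebra p)
              ((IwasawaCharacter.Psi p ℤ_[p] κ σd : (PowerSeries ℤ_[p])ˣ) : IwasawaAlgebra p)
              (A.primeFactors.erase p) (fun ℓ => W.LFunction ℓ) (fun ℓ => if ℓ ∣ N then 0 else 1)
              (fun ℓ => ((IwasawaCharacter.Psi p ℤ_[p] κ (σℓ ℓ) : (PowerSeries ℤ_[p])ˣ) : IwasawaAlgebra p)))) •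
            IK.isogenyMap φ IK hγK (F.iwasawaClass u (κ.restrict K h) hV IK) =
        ((Ideal.absNorm 𝔟 : ℕ) : IwasawaAlgebra p) •
          ((((b₀ : IwasawaAlgebra p) -
              (Nb : IwasawaAlgebra p) * PowerSeries.binomialSeries ℤ_[p] (ZpExtension.artinExponent (κ.restrict K h) 𝔟)) •
              ((PowerSeries.C α₀ : IwasawaAlgebra p) • ((w : IwasawaAlgebra p) • I.resOver IK hγ hγK y) +
                (PowerSeries.C α₁ : IwasawaAlgebra p) •
                  IK.isogenyMap φ IK hγK ((w : IwasawaAlgebra p) • I.resOver IK hγ hγK y))) +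
            (b₁ : IwasawaAlgebra p) •
              IK.isogenyMap φ IK hγK
                ((PowerSeries.C α₀ : IwasawaAlgebra p) • ((w : IwasawaAlgebra p) • I.resOver IK hγ hγK y) +
                  (PowerSeries.C α₁ : IwasawaAlgebra p) •
                    IK.isogenyMap φ IK hγK ((w : IwasawaAlgebra p) • I.resOver IK hγ hγK y)))

/-- **F-P1′ → F-P1**: the normalisation-free letter implies the letter with the Néron normalisation (A2) among its hypotheses — intro the
binders of F-P1 and feed `⟨d, hd.1⟩` (the (A2) conjunct is discarded).  Makes «F-P1 (p821323) is the weaker sibling» a kernel fact.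
[cite: Kato2004Asterisque, §15.16 (15.16.1) (p. 265)] -/
theorem kato15161_ellipticUnitClass_res_zetaFamily_of_free
    (hfree : kato15161_ellipticUnitClass_res_zetaFamily_free) : kato15161_ellipticUnitClass_res_zetaFamily := by
  intro W _ _ hj K _ _ hK ψ hψ hL ι hι f hf hfψ p _ _ _ hbad κ hκ γ hγ I hsurj γK hγK IK F hF he hV φ m hm hφ hp N _ nf hnf ιcyc q Λv
    hq hd
  exact hfree W hj K hK ψ hψ hL ι hι f hf hfψ p hbad κ hκ γ hγ I hsurj γK hγK IK F hF he hV φ m hm hφ hp N _ nf hnf ιcyc q Λv hq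
    ⟨hd.choose, hd.choose_spec.1⟩

end CM

end Literature.NumberTheory.EllipticCurves.Kato2004

end
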